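import Summits.QuantumFields.BalabanUV.Beta.D1BFx.UnitsOnlyK

/-!
COURIER NOTE (beta-d1-p2, 2026-08-20): asym1-g27's staged `HessKerUnitsOnlyK.v1.lean` 005cec4ec245ad27 MINUS the three theorems
`unitS_unitS_inv`, `unitW_unitW_inv`, `hessKer_unitK_only`, which landed byte-identically (same author, probe db38f9adb870afce) as
`Summits/QuantumFields/BalabanUV/Beta/D1BFx/UnitsOnlyK.lean` p207643 and are IMPORTED BY NAME here (dedup rule); every remaining declaration
and docstring is asym1's text unchanged.

# `BalabanUV.Beta.HessKerUnitsOnlyK` — the ONLY-K-RESCALED form of the leg-units invariance of the dressed resolvent Hessian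
# (asymptotic lane asym1, gen 27, v1; generic `d`; bookkeeping only; one import; requested by row D1's road BF-x, CLAIMS.log l.5319 ∕ l.5487)

HONEST FRAMING (cell contract, verbatim): «discharging `BetaPertH` makes Bałaban's UV stability UNCONDITIONAL — a real
constructive-QFT result; it is NOT the continuum limit and NOT the Clay problem.»  THIS MODULE is elementary algebra on matrix-fibred
lattice kernels; it formalises NO statement printed in Bałaban's papers, cites none as a hypothesis, mints no `Prop` fact, instantiates NO
binder of the wall and DISCHARGES NOTHING of it.  NOT summit progress.

ABSOLUTE RULE (cell, verbatim): «No internally-minted statement may enter as a cited fact. Every hypothesis is either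
kernel-proved in this package or a verbatim quotation of a PUBLISHED theorem with page reference. The manuscript(s) under
audit are NOT citable for their own disputed steps — they are the thing under adjudication; programme-internal
(2001/route/tribunal) claims are never citable.»  Every theorem below is kernel-proved; all are [folklore].

PLACEMENT.  New cell work about the cell's typed objects (a CELL RESULT, β-lead RULING (R34-2)) under the registered cell topic
`Summits/QuantumFields/BalabanUV/Beta/`; a one-import leaf of `HessKerDressedUnits` (nothing there is edited; ≤ 400 lines).

WHY.  `HessKerDressedUnits.hessKer_dress_unit` is an INVARIANCE statement: when the resolvent-type kernel is rescaled COVARIANTLY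
(`unitK s_f s_m K = D K D`, `D = diag(s_f on field legs ∣ s_m on multiplier legs)`) and the stencil ∕ second-order tables CONTRAGREDIENTLY
(`unitS`, `unitW`), the dressed one-loop Hessian kernel is unchanged (factor `1`).  Row D1's units check N0(c) (road BF-x, `CHECK-N0.md`)
compares instead the Hessian of the RESCALED kernel `D K D` against the SAME tables.  The only-K-rescaled form below
(`hessKer_unitK_only`) moves the units onto the tables: it equals the Hessian of `K` against the INVERSELY co-dressed tables
`unitS s_f⁻¹ s_m⁻¹ S`, `unitW s_f⁻¹ s_m⁻¹ W`, whose entries are the original ones times explicit leg factors (`unitS_inv_apply`,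
`unitW_inv_apply`: a field leg `× s_f`, a multiplier leg `× s_m`, and `× s_f s_m` overall on a stencil entry).  So the block-size power in
N0(c) is decided TABLE BY TABLE by the leg content of each typed table — content this module does not assert (tables are arbitrary here);
NO exponent and NO normalised object is named.

CONTENT (no `def`, no `Prop`): `unitS_unitS_inv` ∕ `unitS_inv_unitS`, `unitW_unitW_inv` ∕ `unitW_inv_unitW` (inverse units undo the table
maps), `unitS_inv_apply` ∕ `unitW_inv_apply` (entrywise leg factors), **`hessKer_unitK_only`** (only `K` rescaled) and its mirror
**`hessKer_tables_only`** (only the tables rescaled).  RELATION TO THE TREE (no duplication): `hessKer_dress_unit`, `unitS_apply`, `unitW_apply`,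
`legScale_inl` ∕ `legScale_inr` of `HessKerDressedUnits` are USED BY NAME; new here are only the inverse-units identities and the two one-sided
forms.  NOT continuum, NOT Clay.
-/

open Literature.MathematicalPhysics.QuantumFieldTheory.Balaban1983to89
open Literature.MathematicalPhysics.QuantumFieldTheory.Balaban1983to89.Beta
open ExpKernelCalculus (MKer hessKer)
open OneStepResolventKernel (Fib)
open AxialDressing (axDressK axVertexOfK)
open Summit.QuantumFields.BalabanUV.Beta.HessKerDressedUnits
open Summit.QuantumFields.BalabanUV.Beta.D1BFx.UnitsOnlyK (unitS_unitS_inv unitW_unitW_inv hessKer_unitK_only)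

namespace Summit.QuantumFields.BalabanUV.Beta.HessKerUnitsOnlyK

variable {d : ℕ}

/-! ## §1 Inverse units undo the table maps -/

/-- [folklore] `unitS s_f⁻¹ s_m⁻¹ (unitS s_f s_m S) = S`. -/
theorem unitS_inv_unitS {sf sm : ℝ} (hsf : sf ≠ 0) (hsm : sm ≠ 0)
    (S : Fin (d + 1) → (Fin (d + 1) → ℤ) → MKer (d + 1) (Fib d)) : unitS sf⁻¹ sm⁻¹ (unitS sf sm S) = S := by
  simpa only [inv_inv] using unitS_unitS_inv (inv_ne_zero hsf) (inv_ne_zero hsm) S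

/-- [folklore] `unitW s_f⁻¹ s_m⁻¹ (unitW s_f s_m W) = W`. -/
theorem unitW_inv_unitW {sf sm : ℝ} (hsf : sf ≠ 0) (hsm : sm ≠ 0)
    (W : Fin (d + 1) → (Fin (d + 1) → ℤ) → Fin (d + 1) → (Fin (d + 1) → ℤ) → MKer (d + 1) (Fib d)) :
    unitW sf⁻¹ sm⁻¹ (unitW sf sm W) = W := by
  simpa only [inv_inv] using unitW_unitW_inv (inv_ne_zero hsf) (inv_ne_zero hsm) W

/-! ## §2 Entrywise leg factors of the inverse co-dressing -/

/-- [folklore] Entries of `unitS s_f⁻¹ s_m⁻¹ S`: the original entry times `(s_f s_m) · D_a · D_b` (`D = diag(s_f ∣ s_m)`; e.g. a field–field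
entry `× (s_f s_m) s_f²`, a multiplier–multiplier entry `× (s_f s_m) s_m²`). -/
theorem unitS_inv_apply (sf sm : ℝ) (S : Fin (d + 1) → (Fin (d + 1) → ℤ) → MKer (d + 1) (Fib d)) (κ : Fin (d + 1))
    (u x y : Fin (d + 1) → ℤ) (a b : Fib d) :
    unitS sf⁻¹ sm⁻¹ S κ u x y a b = (sf * sm) * (legScale sf sm a * S κ u x y a b * legScale sf sm b) := by
  simp only [unitS_apply, inv_inv, mul_inv]

/-- [folklore] Entries of `unitW s_f⁻¹ s_m⁻¹ W`: the original entry times `D_a · D_b`. -/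
theorem unitW_inv_apply (sf sm : ℝ) (W : Fin (d + 1) → (Fin (d + 1) → ℤ) → Fin (d + 1) → (Fin (d + 1) → ℤ) → MKer (d + 1) (Fib d))
    (μ : Fin (d + 1)) (y : Fin (d + 1) → ℤ) (ν : Fin (d + 1)) (y' : Fin (d + 1) → ℤ) (x z : Fin (d + 1) → ℤ) (a b : Fib d) :
    unitW sf⁻¹ sm⁻¹ W μ y ν y' x z a b = legScale sf sm a * W μ y ν y' x z a b * legScale sf sm b := by
  simp only [unitW_apply, inv_inv]

/-! ## §3 The one-sided forms of `hessKer_dress_unit` -/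

/-- [folklore] **ONLY THE TABLES RESCALED** (mirror form): the dressed Hessian of `K` against `(unitS s_f s_m S, unitW s_f s_m W)` equals the
dressed Hessian of `D⁻¹ K D⁻¹ = unitK s_f⁻¹ s_m⁻¹ K` against `(S, W)`. -/
theorem hessKer_tables_only {sf sm : ℝ} (hsf : sf ≠ 0) (hsm : sm ≠ 0) (N : ℕ) (K : MKer (d + 1) (Fib d))
    (S : Fin (d + 1) → (Fin (d + 1) → ℤ) → MKer (d + 1) (Fib d))
    (W : Fin (d + 1) → (Fin (d + 1) → ℤ) → Fin (d + 1) → (Fin (d + 1) → ℤ) → MKer (d + 1) (Fib d)) :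
    hessKer (axDressK N K) (axVertexOfK K N (unitS sf sm S)) (unitW sf sm W) =
      hessKer (axDressK N (unitK sf⁻¹ sm⁻¹ K)) (axVertexOfK (unitK sf⁻¹ sm⁻¹ K) N S) W := by
  have h := hessKer_unitK_only (inv_ne_zero hsf) (inv_ne_zero hsm) N K S W
  simp only [inv_inv] at h
  exact h.symm

end Summit.QuantumFields.BalabanUV.Beta.HessKerUnitsOnlyK
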